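import Summits.ResolutionOfSingularities.ResolutionOfSingularities.Theorems.FrobeniusClosingPatchingRelPerfectDepthPhaseCCarrierGameLiftAmbient
import Summits.ResolutionOfSingularities.ResolutionOfSingularities.Theorems.FrobeniusClosingPatchingRelPerfectMonomialRouteKOrder
import HarnessLib

/-!
# Crux `PatchingRelPerfect` (stmt-ResolutionOfSingularities-16161), chain W5.2 — F7(β) (β-AX) X3 C-I (G2) engine:
# MARKED ORDER REDUCTION OF A MONOMIAL SUM ON ONE PATCH (the marking-`m` dictionary over Route K)

[OURS · L1 W5.2 · res-D-pv-046 DESIGN NOTE 21:18Z on RULINGS G12-49 (3) («per patch even Route K suffices; the marking-`m` twin of the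
P2 dictionary is the only new scheme file per patch»); sibling of `…CarrierGameLiftDictionary` p556791 (marking `1`) and (C0)
`…MonomialPatchLift` p564474] Replaces the role of NO printed item; NOT a statement of the manuscript under review; fact-free; any dimension.

On ONE patch — a regular locally Noetherian scheme `X₀` carrying an snc letter list `Es` and GLOBAL exponent rows `𝒦` — Hironaka's
polyhedra game with marking `m ≥ 1` is won by the tree (`PolyhedraGame.routeKTarget`), and the marked dictionary turns the win into
MARKED ORDER REDUCTION of `(Σ 𝒦, Es, m)`: an admissible `CentreSeq` (regular strata inside `Sing(Σ𝒦, m)`, snc with the boundary)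
whose final transform has EMPTY marked support, i.e. order `< m` everywhere, and is again a monomial sum in the transformed snc letters.

* `forall_le_weightAt_of_mem_support_centre` — the centre of an `m`-permissible move lies in `Sing(Σ𝒦, m)`.
* `support_marked_eq_empty_of_wonM` — an `m`-won state has empty marked support.
* **`exists_isAdmissibleFor_of_winnablePos`** — `WinnablePos m s`, `GameInv s Es 𝒦 lab` ⟹ `∃ t`, `t.IsAdmissibleFor ⟨Σ𝒦, Es, m⟩`,
  regular top, `(t.transformMarked ⟨Σ𝒦, Es, m⟩).support = ∅`, and the final transform is `(Σ𝒦', Es', m)` for an snc `Es'` and rows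
  `𝒦' ≠ []` on it (so it is again END on the whole top).
* **`monomialPatchOrderReduction`** — the same from the Route-K win for an snc, pointed-distinct `Es` and `𝒦 ≠ []`, any `m ≥ 1`:
  the ONE-PATCH case of (G-T) `EndOrderReduction m` (`…DepthPhaseCX3Defs`), with `K·𝒪 = M·K₁`, `M` effective Cartier
  (`CarrierGoingUp.exists_isEffectiveCartier_mul_transformMarked_ideal`).

AI-written; AI review is weaker than expert review.

## References (for the mathematics; nothing here is a statement of the manuscript under review)
* J. Kollár, *Lectures on Resolution of Singularities* (2007), (3.111) Step 3, Def. 3.65. [Kollar2007]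
* E. Bierstone, D. Grigoriev, P. Milman, J. Włodarczyk, arXiv:1206.3090, Def. 3.1.3, Lemma 3.2.1. [BierstoneGrigorievMilmanWlodarczyk2011]
* E. Bierstone, P. Milman, *Desingularization of toric and binomial varieties*, J. Alg. Geom. 15 (2006), Thm 8.5. [BierstoneMilman2006]
-/

-- `Summit.<Summit>.<Sub>.Theorems` with `Sub = Summit` (single-conjunct summit, D-0017)
set_option linter.dupNamespace false

noncomputable section

open CategoryTheory AlgebraicGeometry TopologicalSpace IsLocalRing
open Literature.AlgebraicGeometry.Resolution

namespace Summit.ResolutionOfSingularities.ResolutionOfSingularities.Theorems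

namespace MonomialCleanup

open DepthTargets (monomialSum monomialSum_nil monomialSum_cons)
open PolyhedraGame (State WinnablePos WonM PermissibleM Permissible move weight weight_mono permissibleM_one_iff
  routeKTarget winnablePos_of_routeKTarget)

universe u

variable {X X' : Scheme.{u}}

/-! ## The marked read-outs -/

open Classical in
/-- **The centre of an `m`-permissible move lies in `Sing(Σ𝒦, m)`**: at a point of `V({Es[k] : lab k ∈ J})` every member has weight `≥ m`
(its game vector has weight `≥ m` on `J`, and `J` labels positions all passing through the point). [cite: Kollar2007, Def. 3.65] -/
theorem forall_le_weightAt_of_mem_support_centre {s : State} {Es : List X.IdealSheafData} {𝒦 : List (List (X.IdealSheafData × ℕ))}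
    {lab : ℕ → ℕ} (hinv : GameInv s Es 𝒦 lab) {m : ℕ} {J : Finset ℕ} (hJ : PermissibleM m s J) {x : X}
    (hx : x ∈ ((((posOf Es lab J).image (nthSheaf Es)).sup id).support : Set X)) : ∀ A ∈ 𝒦, m ≤ weightAt A x := by
  intro A hA
  obtain ⟨hJstr, -, hJw⟩ := hJ
  have hJB : J ⊆ s.B := hinv.str_B J hJstr
  set S : Finset ℕ := (Finset.range Es.length).filter fun k => x ∈ (nthSheaf Es k).support with hS
  have hSiff : ∀ k, k ∈ S ↔ k < Es.length ∧ x ∈ (nthSheaf Es k).support := fun k => by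
    rw [hS, Finset.mem_filter, Finset.mem_range]
  have hxP : ∀ k ∈ posOf Es lab J, x ∈ (nthSheaf Es k).support := fun k hk =>
    (mem_support_finsetSup_iff _ x).mp hx _ (Finset.mem_image_of_mem _ hk)
  have hPS : posOf Es lab J ⊆ S := fun k hk => (hSiff k).mpr ⟨(mem_posOf_iff.mp hk).1, hxP k hk⟩
  obtain ⟨α, hα, hagr⟩ := hinv.fwd A hA
  have h1 : weight J α ≤ weight (S.image lab) α := by
    rw [← image_lab_posOf hinv hJB]
    exact weight_mono (Finset.image_subset_image hPS) α
  rw [← hinv.weight_image_lab_eq_weightAt hA hagr hSiff]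
  exact (hJw α hα).trans h1

open Classical in
/-- **An `m`-won state has empty marked support**: at every point some member has weight `< m`. [cite: Kollar2007, (3.111) Step 3] -/
theorem support_marked_eq_empty_of_wonM {s : State} {Es : List X.IdealSheafData} {𝒦 : List (List (X.IdealSheafData × ℕ))}
    {lab : ℕ → ℕ} (hinv : GameInv s Es 𝒦 lab) {m : ℕ} (hwon : WonM m s) :
    (⟨monomialSum 𝒦, Es, m⟩ : MarkedIdeal X).support = ∅ := by
  refine Set.eq_empty_iff_forall_notMem.mpr fun x hx => ?_
  set S : Finset ℕ := (Finset.range Es.length).filter fun k => x ∈ (nthSheaf Es k).support with hS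
  have hSiff : ∀ k, k ∈ S ↔ k < Es.length ∧ x ∈ (nthSheaf Es k).support := fun k => by
    rw [hS, Finset.mem_filter, Finset.mem_range]
  have hstr : S.image lab ∈ s.Str := hinv.image_lab_mem_str fun k hk => (hSiff k).mp hk
  obtain ⟨α, hα, hlt⟩ := hwon _ hstr
  obtain ⟨A, hA, hw⟩ := hinv.exists_member_weightAt_eq hα hSiff
  have hle := (PolyhedraGame.RouteK.mem_support_monomialSum_marked_iff 𝒦 (fun B hB => by rw [hinv.bd B hB]; exact hinv.snc)
    Es m x).mp hx A hA
  rw [hw] at hle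
  exact absurd (lt_of_le_of_lt hle hlt) (lt_irrefl _)

/-! ## The induction on `WinnablePos m` -/

open Classical in
/-- **A marking-`m` winnable state reduces the order of `(Σ 𝒦, Es, m)` below `m`** (marking-`m` twin of
`exists_isAdmissibleFor_of_winnablePos_one`): an admissible `CentreSeq`, regular top, EMPTY final marked support, and the final
transform again a monomial sum over an snc letter list. [cite: Kollar2007, (3.111) Step 3] [cite: BierstoneGrigorievMilmanWlodarczyk2011, Def. 3.1.3] -/
theorem exists_isAdmissibleFor_of_winnablePos {m : ℕ} {s : State} (hw : WinnablePos m s) :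
    ∀ (X : Scheme.{u}) [IsLocallyNoetherian X] (Es : List X.IdealSheafData)
      (𝒦 : List (List (X.IdealSheafData × ℕ))) (lab : ℕ → ℕ), GameInv s Es 𝒦 lab →
      ∃ t : CentreSeq X, t.IsAdmissibleFor ⟨monomialSum 𝒦, Es, m⟩ ∧ Scheme.IsRegular t.top ∧
        (t.transformMarked ⟨monomialSum 𝒦, Es, m⟩).support = ∅ ∧
        HasSNC (t.transformMarked ⟨monomialSum 𝒦, Es, m⟩).boundary ∧
        ∃ 𝒦' : List (List (t.top.IdealSheafData × ℕ)), 𝒦'.length = 𝒦.length ∧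
          (∀ A ∈ 𝒦', boundaryOf A = (t.transformMarked ⟨monomialSum 𝒦, Es, m⟩).boundary) ∧
          (t.transformMarked ⟨monomialSum 𝒦, Es, m⟩).ideal = monomialSum 𝒦' := by
  induction hw with
  | done hwon =>
    intro X _ Es 𝒦 lab hinv
    exact ⟨CentreSeq.nil X, trivial, fun x => (hinv.snc x).1, support_marked_eq_empty_of_wonM hinv hwon, hinv.snc,
      𝒦, rfl, hinv.bd, rfl⟩
  | @step s J hJ he _ ih =>
    intro X _ Es 𝒦 lab hinv
    set P := posOf Es lab J with hPdef
    set T := P.image (nthSheaf Es) with hTdef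
    set C : X.IdealSheafData := T.sup id with hC
    have hJB : J ⊆ s.B := hinv.str_B J hJ.1
    have hPlt : ∀ k ∈ P, k < Es.length := fun k hk => (mem_posOf_iff.mp hk).1
    have hT : ∀ K ∈ T, K ∈ Es := image_nthSheaf_subset hPlt
    have hπ : IsBlowup (blowup.π C) (T.sup id) := blowup.isBlowup C
    haveI : IsLocallyNoetherian (blowup C) := CentreSeq.isLocallyNoetherian_blowup C
    have hinv' := gameInv_move_of_permissibleM (π := blowup.π C) (e := s.B.card) hinv hJ he hπ
    obtain ⟨t, hadm, htop, hsupp, hsnc', 𝒦', hlen, hbd', hideal⟩ := ih (blowup C) _ _ _ hinv'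
    -- the transformed marked ideal is the successor datum
    have hkey : controlledTransform (blowup.π C) (T.sup id) (monomialSum 𝒦) m =
        monomialSum (𝒦.map fun A => transformExp A (blowup.π C) T m) := by
      by_cases hCtop : T.sup id = ⊤
      · -- empty centre: both sides are the total transform
        rw [controlledTransform, hCtop, Scheme.IdealSheafData.comap_top, ← Scheme.IdealSheafData.one_eq_top, one_pow,
          Scheme.IdealSheafData.one_eq_top, colon_top, monomialSum_map_transformExp_eq_of_sup_eq_top hCtop,
          comap_monomialSum_eq_pow_mul hinv.snc hinv.bd hT hπ (m := 0) (fun A _ => Nat.zero_le _), pow_zero, one_mul]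
      · -- non-empty centre: a common point of the positions of `J`, weights `≥ m`
        have hne : ((T.sup id).support : Set X).Nonempty := by
          by_contra h
          have hbot : (T.sup id).support = ⊥ := le_bot_iff.mp fun x hx => (h ⟨x, hx⟩).elim
          exact hCtop ((Scheme.IdealSheafData.support_eq_bot_iff (I := T.sup id)).mp hbot)
        obtain ⟨x, hx⟩ := hne
        have hPx : ∀ k ∈ P, x ∈ (nthSheaf Es k).support := fun k hk =>
          (mem_support_finsetSup_iff T _).mp hx _ (Finset.mem_image_of_mem _ hk)
        refine DepthMultiHost.controlledTransform_monomialSum_stratum hinv.snc hinv.bd hT hπ fun A hA => ?_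
        obtain ⟨α, hα, hagr⟩ := hinv.fwd A hA
        have hlenA : A.length = Es.length := hinv.length_eq hA
        have hPD : PointedDistinct (boundaryOf A) := (hinv.bd A hA).symm ▸ hinv.pd
        have hPltA : ∀ k ∈ P, k < A.length := fun k hk => hlenA ▸ hPlt k hk
        have hPxA : ∀ k ∈ P, x ∈ (nthSheaf (boundaryOf A) k).support := fun k hk => by
          rw [hinv.bd A hA]; exact hPx k hk
        have hw := weightOf_image_nthSheaf_eq_sum hPD hPltA hPxA
        rw [hinv.bd A hA] at hw
        rw [hw, show ∑ k ∈ P, nthExp A k = ∑ k ∈ P, α (lab k) from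
          Finset.sum_congr rfl fun k hk => (hagr k (hPlt k hk) ⟨x, hPx k hk⟩).symm, ← weight_eq_sum_posOf hinv hJB]
        exact hJ.2.2 α hα
    have htr : (⟨monomialSum 𝒦, Es, m⟩ : MarkedIdeal X).transform (blowup.π C) C =
        ⟨monomialSum (𝒦.map fun A => transformExp A (blowup.π C) T m),
          Es.map (strictTransformIdeal (blowup.π C) (T.sup id)) ++ [(T.sup id).comap (blowup.π C)], m⟩ := by
      simp only [MarkedIdeal.transform, hC, hkey]
    refine ⟨CentreSeq.cons C t, ?_, htop, ?_, ?_, 𝒦', ?_, ?_, ?_⟩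
    · refine (CentreSeq.isAdmissibleFor_cons C t _).mpr ⟨?_, hinv.snc.hasSNCWith_finsetSup T hT,
        hinv.snc.isRegular_subscheme_finsetSup T hT, ?_⟩
      · intro x hx
        exact (PolyhedraGame.RouteK.mem_support_monomialSum_marked_iff 𝒦
          (fun B hB => by rw [hinv.bd B hB]; exact hinv.snc) Es m x).mpr
          (forall_le_weightAt_of_mem_support_centre hinv hJ hx)
      · rw [htr]; exact hadm
    · rw [CentreSeq.transformMarked_cons, htr]; exact hsupp
    · rw [CentreSeq.transformMarked_cons, htr]; exact hsnc'
    · rw [List.length_map] at hlen; exact hlen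
    · rw [CentreSeq.transformMarked_cons, htr]; exact hbd'
    · rw [CentreSeq.transformMarked_cons, htr]; exact hideal

/-! ## Marked order reduction on one patch -/

/-- [OURS · L1 W5.2] **MARKED ORDER REDUCTION OF A MONOMIAL SUM ON ONE PATCH** (the one-patch case of (G-T) `EndOrderReduction m`):
on a regular locally Noetherian `X₀` with an snc, pointed-distinct letter list `Es` and rows `𝒦 ≠ []`, for every marking `m ≥ 1` there is
an admissible `CentreSeq` for `(Σ 𝒦, Es, m)` (regular strata inside `Sing(Σ𝒦, m)`, snc with the boundary), with regular top, EMPTY final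
marked support (order `< m` everywhere), the final transform again a monomial sum `Σ 𝒦'` (`|𝒦'| = |𝒦|`) over the transformed snc letters,
and `(Σ𝒦)·𝒪_top = M · Σ𝒦'` with `M` effective Cartier. (Route K's win `PolyhedraGame.routeKTarget` through the marking-`m` dictionary.)
[cite: Kollar2007, (3.111) Step 3] [cite: BierstoneGrigorievMilmanWlodarczyk2011, Def. 3.1.3] -/
theorem monomialPatchOrderReduction {X₀ : Scheme.{u}} [IsLocallyNoetherian X₀]
    (Es : List X₀.IdealSheafData) (hEs : HasSNC Es) (hpd : PointedDistinct Es)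
    (𝒦 : List (List (X₀.IdealSheafData × ℕ))) (hbd : ∀ A ∈ 𝒦, boundaryOf A = Es) (h𝒦 : 𝒦 ≠ []) {m : ℕ} (hm : 1 ≤ m) :
    ∃ t : CentreSeq X₀, t.IsAdmissibleFor ⟨monomialSum 𝒦, Es, m⟩ ∧ Scheme.IsRegular t.top ∧
      (t.transformMarked ⟨monomialSum 𝒦, Es, m⟩).support = ∅ ∧
      HasSNC (t.transformMarked ⟨monomialSum 𝒦, Es, m⟩).boundary ∧
      (∃ 𝒦' : List (List (t.top.IdealSheafData × ℕ)), 𝒦' ≠ [] ∧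
        (∀ A ∈ 𝒦', boundaryOf A = (t.transformMarked ⟨monomialSum 𝒦, Es, m⟩).boundary) ∧
        (t.transformMarked ⟨monomialSum 𝒦, Es, m⟩).ideal = monomialSum 𝒦') ∧
      ∃ M : t.top.IdealSheafData, IsEffectiveCartier M ∧
        (monomialSum 𝒦).comap t.comp = M * (t.transformMarked ⟨monomialSum 𝒦, Es, m⟩).ideal := by
  classical
  have hw : WinnablePos m (initialState Es.length 𝒦) :=
    winnablePos_of_routeKTarget (routeKTarget hm) _ (initialState_wf Es.length h𝒦) Es.length rfl
  obtain ⟨t, hadm, hreg, hsupp, hsnc', 𝒦', hlen, hbd', hideal⟩ :=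
    exists_isAdmissibleFor_of_winnablePos hw X₀ Es 𝒦 id (gameInv_initialState_of_pointedDistinct hEs hpd hbd)
  obtain ⟨M, hM, hEq⟩ := CarrierGoingUp.exists_isEffectiveCartier_mul_transformMarked_ideal t ⟨monomialSum 𝒦, Es, m⟩ hadm
  refine ⟨t, hadm, hreg, hsupp, hsnc', ⟨𝒦', ?_, hbd', hideal⟩, M, hM, hEq⟩
  intro h
  rw [h, List.length_nil] at hlen
  exact h𝒦 (List.eq_nil_of_length_eq_zero hlen.symm)

end MonomialCleanup

end Summit.ResolutionOfSingularities.ResolutionOfSingularities.Theorems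

end
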